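import Summits.BirchSwinnertonDyer.BirchSwinnertonDyer.Theorems.ErratumRoadFiveTwoVariableControlHom
import Summits.BirchSwinnertonDyer.BirchSwinnertonDyer.Theorems.ErratumRoadFiveTwoVariableControlDual
import Summits.BirchSwinnertonDyer.BirchSwinnertonDyer.Theorems.ErratumRoadFiveTwoVariableCharIdealDescent
import Summits.BirchSwinnertonDyer.BirchSwinnertonDyer.Theorems.ErratumRoadFiveBigRepInvariants
import Literature.NumberTheory.EllipticCurves.BigGaloisRepLocalInputs
import Literature.NumberTheory.EllipticCurves.SelmerCocycleLiftUnramifiedFiniteProofs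
import Literature.NumberTheory.EllipticCurves.OrdinaryNewformDatumCofreeUnramified
import Mathlib.RingTheory.AdicCompletion.Completeness
import HarnessLib

/-!
# Two-variable CONTROL ([JSW17, Lemma 3.4.1]) for the erratum's Selmer groups — PROVED in the exact
# case: `X^Σ_K(𝓜)/(γ₊ − 1) ⥲ X^Σ_ac(M)` and `X^Σ_K(𝓜)` finitely generated over `Λ_K`, for every
# big representation over `Γ_K` with no `Γ_K`- and no `Γ_{K_𝔮}`-fixed `p`-torsion, unramified off `Σ`;
# in particular for `A_g` of an ordinary newform datum (helper, `--supports stmt-BirchSwinnertonDyer-25505`)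

Cell `bsd-stepL`, seat `bsd-stepL-imc-p1` (prover g21, 2026-08-28). Theorems only (no definition, no
named fact, no `sorry`, no instance, no notation). Sixth file of the `complete` cut of crux 25505
`ErratumThm23SigmaLe`; assembles `ErratumRoadFiveTwoVariableControlHom` (Selmer side) and
`ErratumRoadFiveTwoVariableControlDual` (Pontryagin-dual side) at the erratum's local data
`(localMap K, strictSet p 𝔮 Σ)` of `BigGaloisRep.selmerBig` ∕ `XBig`.

## What is proved

* §1 `hloc_iterate` — the constrained LOCAL inputs of the torsion control at `r = T_c` for the
  iterate `𝓜 = AnticyclotomicBigGaloisRep κ' (AnticyclotomicBigGaloisRep κ ρ)`: at the decomposition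
  index `𝔮` the invariants `𝓜^{Γ_{K_𝔮}}` VANISH as soon as `A` has no non-zero `Γ_{K_𝔮}`-fixed
  `p`-power-torsion element (the tree's invariants criterion twice,
  `ControlInputs.bigRep_bigRep_invariants_eq_bot`; = erratum Lemma 2.1's "vanishes when so does
  `H⁰(K_𝔭̄, A_g[ϖ])`"); at an inertia index `w ∉ Σ`, `w ∤ p` the restricted representation is trivial
  (both `ℤ_p`-extensions are unramified at `w`, `ZpExtension.apply_localMap_inr`; `A` is unramified
  there) and `T_c` is onto `𝓜`. So the control defect `⊕_v 𝓜^{Γ_v}/T_c` ([JSW17] p. 14) is ZERO.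
* §2 `exists_controlMap` — **exact control**: under (glob) no `Γ_K`-fixed, (dec) no `Γ_{K_𝔮}`-fixed
  `p`-power torsion in `A`, (unr): a `Λ`-linear `f : X^Σ(𝓜)/T_c → X^Σ(M)` (`X = XBig`, quotient a
  `Λ`-module through `C`) which is SURJECTIVE with KERNEL `⊥` (hence pseudo-null);
  `module_finite_XBig_iterate` — `X^Σ(𝓜)` is a finitely generated `Λ⟦X⟧`-module if `X^Σ(M)` is a
  finitely generated `Λ`-module.
* §3 `control_newform` — the same for `A_g = K²/𝒪²` of an ordinary newform datum `Δ` of a NEWFORM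
  `g ∈ S_k(Γ₀(M))` over any number field `K`, any two `ℤ_p`-extensions `κ, κ'`, any `𝔮`, any finite
  `Σ ⊇ {w ∣ M}`: hypotheses (glob) and (dec) only ((unr) is the tree's
  `cofreeRepOver_localMap_inr_apply_eq_self`, finite generation of `X^Σ_ac(A_g)` the tree's
  `SkinnerUrban2014.moduleFinite_XBig_newform`). Its conclusion is LITERALLY the conclusion of the
  stub `stub_control` of `Cruxes/ErratumThm23SigmaLe/Lines/erratum_chain.lean` (v2, RULING 51).

## On the hypotheses (for the line's planner; see the seat's memo `CONTROL-25505-imc-p1-g21.md`)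

[JSW17, Lemma 3.4.1] proves "finite kernel" under §3.1's (HT) ("no non-zero Hodge–Tate weight of `V`
is `≡ 0 mod p − 1`") by a `p`-adic Hodge-theoretic analysis of `T^{P_v}` (Case 3(b), p. 13) for the
SELF-DUAL twist `V = V_g(1 − k/2)`. The tree's `Δ.cofreeRepOver K` is the UNTWISTED `A_g = V_g/T_g`
(`OrdinaryNewformDatum.charpoly`: `X² − a_ℓ X + ℓ^{k−1}`), and `OrdinaryNewformDatum` records neither
Frobenius-at-`p` eigenvalues nor Hodge–Tate weights, so (HT) cannot be consumed here; the consumable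
input is (dec) = "`H⁰(K_𝔮, A_g[ϖ]) = 0`" (erratum Lemma 2.1's own hypothesis; for the members `g_m` of
K2's Hida family it is hypothesis (iv) `E(ℚ_p)[p] = 0` through the congruence `ρ̄_{g_m} ≅ ρ̄_E`), under
which the control is EXACT. (glob) is (irr_K) in element form ("`H⁰(K, M_g) = 0` by … irreducibility").

HONEST FRAMING: cohomological bookkeeping on the tree's constructed carriers + the tree's proved
finiteness [SU14, L.3.1.9]; conditional on nothing; nothing about BSD for any pair; closes: none (T7).

## References
* [JetchevSkinnerWan2017] §3.4, Lemma 3.4.1 and proof; Prop. 3.3.? proof, Case 3(b) (arXiv:1512.06894 pp. 12–14).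
* [Castella2018Erratum] Lemma 2.1 (p. 2).
* [SkinnerUrban2014] Lemma 3.1.9 (p. 20).
-/

noncomputable section

open CategoryTheory Field IsDedekindDomain NumberField
open Literature.NumberTheory.GaloisRepresentations Literature.NumberTheory.EllipticCurves
  Literature.NumberTheory.EllipticCurves.BigGaloisRep
  Summit.BirchSwinnertonDyer.Rank1Residual.X11b
open scoped ContRepresentation Pointwise

-- D-0017: single-problem summit, the namespace repeats the problem name by design.
set_option linter.dupNamespace false
set_option autoImplicit false

namespace Summit.BirchSwinnertonDyer.BirchSwinnertonDyer.Theorems.ErratumThm23TwoVariable.ControlAt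

universe u

/-! ## §1 The constrained local inputs for the iterate: no control defect -/

section Local

variable {K : Type u} [Field K] [NumberField K] {p : ℕ} [Fact p.Prime]
  {𝒪 : Type*} [CommRing 𝒪] [TopologicalSpace 𝒪]
  {A : Type u} [AddCommGroup A] [Module 𝒪 A] [TopologicalSpace A] [DiscreteTopology A]
  [TopologicalSpace (PowerSeries 𝒪)] [TopologicalSpace (PowerSeries (PowerSeries 𝒪))]
  [ContinuousSMul (PowerSeries (PowerSeries 𝒪))
    (BigRepModule (PowerSeries 𝒪) p (BigRepModule 𝒪 p A))]

/-- **The constrained local invariants of the iterate are `T_c`-divisible** at every index of the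
erratum's strict set: at `Sum.inl 𝔮` they VANISH ((dec): no non-zero `Γ_{K_𝔮}`-fixed `p`-power
torsion in `A` — "the kernel of the second arrow is given by `H⁰(K_𝔭, M_g)/ϖ^m H⁰(K_𝔭, M_g)` and this
vanishes when so does `H⁰(K_𝔭, A_g[ϖ])`"), at `Sum.inr w` (`w ∉ Σ`, `w ∤ p`) the restricted
representation is trivial ((unr) + `ℤ_p`-extensions unramified outside `p`) and `T_c` is onto. Hence
the control defect "`𝓜^{G_{K_v}}/(γ₊ − 1)𝓜^{G_{K_v}}`" of [JSW17] is zero at every constrained `v`.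
[cite: JetchevSkinnerWan2017, Lemma 3.4.1, proof (arXiv:1512.06894 p. 14)]
[cite: Castella2018Erratum, Lemma 2.1, proof (p. 2)] -/
theorem hloc_iterate (κ κ' : ZpExtension K p)
    (ρ : ContinuousRep (absoluteGaloisGroup K) 𝒪 A) (𝔮 : HeightOneSpectrum (𝓞 K))
    (S : Set (HeightOneSpectrum (𝓞 K)))
    (hdec : ∀ a : A, (∀ σ : LocalGroup K (Sum.inl 𝔮), ρ (localMap K (Sum.inl 𝔮) σ) a = a) →
      (∃ k : ℕ, p ^ k • a = 0) → a = 0)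
    (hunr : ∀ w : HeightOneSpectrum (𝓞 K), w ∉ S → ((p : ℕ) : 𝓞 K) ∉ w.asIdeal →
      ∀ (σ : LocalGroup K (Sum.inr w)) (a : A), ρ (localMap K (Sum.inr w) σ) a = a) :
    ∀ v ∈ strictSet p 𝔮 S,
      ∀ w ∈ (((AnticyclotomicBigGaloisRep κ' (AnticyclotomicBigGaloisRep κ ρ)).restrict
          (localMap K v)).toTopRep).ρ.invariants,
        ∃ w' ∈ (((AnticyclotomicBigGaloisRep κ' (AnticyclotomicBigGaloisRep κ ρ)).restrict
          (localMap K v)).toTopRep).ρ.invariants,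
          (PowerSeries.X : PowerSeries (PowerSeries 𝒪)) • w' = w := by
  rintro (w | w) hv x hx
  · -- decomposition index `w = 𝔮`: the invariants vanish
    rw [inl_mem_strictSet_iff] at hv
    subst hv
    have h0 : (((AnticyclotomicBigGaloisRep κ' (AnticyclotomicBigGaloisRep κ ρ)).restrict
        (localMap K (Sum.inl w))).toTopRep).ρ.invariants = ⊥ := by
      change (((bigRep κ'.toContinuousMonoidHom (bigRep κ.toContinuousMonoidHom ρ)).restrict
        (localMap K (Sum.inl w))).toTopRep).ρ.invariants = ⊥
      rw [bigRep_restrict, bigRep_restrict]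
      exact ControlInputs.bigRep_bigRep_invariants_eq_bot _ _ (ρ.restrict (localMap K (Sum.inl w)))
        fun a ha hk ↦ hdec a (fun σ ↦ by simpa only [ContinuousRep.restrict_apply] using ha σ) hk
    rw [h0, Submodule.mem_bot] at hx
    subst hx
    exact ⟨0, Submodule.zero_mem _, smul_zero _⟩
  · -- inertia index: the restricted representation is trivial and `T_c` is onto
    rw [inr_mem_strictSet_iff] at hv
    obtain ⟨x', hx'⟩ := ControlInputs.X_smul_surjective_iterate (𝒪 := 𝒪) (p := p) (A := A) x
    refine ⟨x', ?_, hx'⟩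
    have htop := BigRep.bigRep_restrict_invariants_eq_top (p := p) κ'.toContinuousMonoidHom
      (bigRep (p := p) κ.toContinuousMonoidHom ρ) (localMap K (Sum.inr w))
      (fun h ↦ by
        rw [ZpExtension.coe_toContinuousMonoidHom]; exact ZpExtension.apply_localMap_inr κ' hv.2 h)
      (fun h m ↦ BigRep.bigRep_restrict_apply_eq_self κ.toContinuousMonoidHom ρ
        (localMap K (Sum.inr w))
        (fun h' ↦ by
          rw [ZpExtension.coe_toContinuousMonoidHom]; exact ZpExtension.apply_localMap_inr κ hv.2 h')
        (fun h' a ↦ hunr w hv.1 hv.2 h' a) h m)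
    change x' ∈ (((bigRep κ'.toContinuousMonoidHom (bigRep κ.toContinuousMonoidHom ρ)).restrict
        (localMap K (Sum.inr w))).toTopRep).ρ.invariants
    rw [htop]
    exact Submodule.mem_top

end Local

/-! ## §2 Exact control and finite generation at `(Γ_K, localMap K, strictSet p 𝔮 Σ)` -/

section Control

variable {K : Type u} [Field K] [NumberField K] {p : ℕ} [Fact p.Prime]
  {𝒪 : Type*} [CommRing 𝒪] [TopologicalSpace 𝒪]
  {A : Type u} [AddCommGroup A] [Module 𝒪 A] [TopologicalSpace A] [DiscreteTopology A]
  [TopologicalSpace (PowerSeries 𝒪)] [TopologicalSpace (PowerSeries (PowerSeries 𝒪))]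
  [ContinuousSMul (PowerSeries 𝒪) (BigRepModule 𝒪 p A)]
  [ContinuousSMul (PowerSeries (PowerSeries 𝒪))
    (BigRepModule (PowerSeries 𝒪) p (BigRepModule 𝒪 p A))]
  (κ κ' : ZpExtension K p) (ρ : ContinuousRep (absoluteGaloisGroup K) 𝒪 A)
  (𝔮 : HeightOneSpectrum (𝓞 K)) (S : Set (HeightOneSpectrum (𝓞 K)))

/-- The control injection of `ControlHom.exists_controlHom` AT the erratum's data, with its range made
EXACT by §1: an injective `C`-semilinear additive `θ : Sel^Σ_𝔮(K, M) → Sel^Σ_𝔮(K, 𝓜)` killed by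
`T_c` and reaching every `T_c`-torsion Selmer class of `𝓜` ("`H¹_{ac}(K, M) ⥲ H¹_{Gr}(K, 𝓜)[γ₊ − 1]`").
[cite: JetchevSkinnerWan2017, §3.4 and Lemma 3.4.1 (arXiv:1512.06894 p. 14)]
[cite: Castella2018Erratum, Lemma 2.1 (p. 2)] -/
theorem exists_controlHom_selmerBig
    (hA : ∀ a : A, (∀ g : absoluteGaloisGroup K, ρ g a = a) → (∃ k : ℕ, p ^ k • a = 0) → a = 0)
    (hdec : ∀ a : A, (∀ σ : LocalGroup K (Sum.inl 𝔮), ρ (localMap K (Sum.inl 𝔮) σ) a = a) →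
      (∃ k : ℕ, p ^ k • a = 0) → a = 0)
    (hunr : ∀ w : HeightOneSpectrum (𝓞 K), w ∉ S → ((p : ℕ) : 𝓞 K) ∉ w.asIdeal →
      ∀ (σ : LocalGroup K (Sum.inr w)) (a : A), ρ (localMap K (Sum.inr w) σ) a = a) :
    ∃ θ : selmerBig κ ρ 𝔮 S →+ selmerBig κ' (AnticyclotomicBigGaloisRep κ ρ) 𝔮 S,
      Function.Injective θ ∧
      (∀ (f : PowerSeries 𝒪) (s : selmerBig κ ρ 𝔮 S),
        θ (f • s) = (PowerSeries.C f : PowerSeries (PowerSeries 𝒪)) • θ s) ∧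
      (∀ s, (PowerSeries.X : PowerSeries (PowerSeries 𝒪)) • θ s = 0) ∧
      (∀ y : selmerBig κ' (AnticyclotomicBigGaloisRep κ ρ) 𝔮 S,
        (PowerSeries.X : PowerSeries (PowerSeries 𝒪)) • y = 0 → y ∈ Set.range θ) := by
  obtain ⟨θ, hinj, hC, hmem, hsurj⟩ := ControlHom.exists_controlHom (localMap K) (strictSet p 𝔮 S)
    κ'.toContinuousMonoidHom κ.toContinuousMonoidHom ρ hA
  refine ⟨θ, hinj, hC, fun s ↦ ?_, fun y hy ↦ hsurj y ?_⟩
  · -- `T_c • H¹(ι) x = 0`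
    obtain ⟨x, -, hx⟩ := hmem s
    have h := TorsionControl.smul_cohomologyMap_torsionIncl
      (bigRep (p := p) κ'.toContinuousMonoidHom (bigRep (p := p) κ.toContinuousMonoidHom ρ))
      (PowerSeries.X : PowerSeries (PowerSeries 𝒪)) x
    rw [← TorsionControl.torsionInclH1_apply, hx] at h
    exact Subtype.ext h
  · -- a `T_c`-torsion Selmer class of `𝓜` comes from `Sel(𝓜[T_c])` (no control defect, §1)
    rw [TorsionControl.map_torsionInclH1_selmer (localMap K) (strictSet p 𝔮 S) _ _
      ControlInputs.X_smul_surjective_iterate (hloc_iterate κ κ' ρ 𝔮 S hdec hunr),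
      Submodule.mem_inf, Submodule.mem_torsionBy_iff]
    exact ⟨y.2, by rw [← Submodule.coe_smul, hy, Submodule.coe_zero]⟩

set_option maxHeartbeats 800000 in
-- the STATEMENT (iterated big representation, three `letI` constants structures on the quotient) costs more
-- than the default budget, as for `AtData.map_charIdeal_le_span_of_twoVariable_of_control`; the proof is glue
/-- **Exact two-variable control** ("the kernel of the surjection
`X^Σ_{Gr}(𝓜)/(γ₊ − 1)X^Σ_{Gr}(𝓜) ↠ X^Σ_{ac}(M)` has finite order" — here: is ZERO). For `κ, κ'` two
`ℤ_p`-extensions of a number field `K`, a discrete `𝒪`-linear `ρ` on `A` with (glob) no non-zero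
`Γ_K`-fixed and (dec) no non-zero `Γ_{K_𝔮}`-fixed `p`-power-torsion element and (unr) unramified at
every finite `w ∉ Σ`, `w ∤ p`: there is a `Λ`-linear map
`f : X^Σ(𝓜)/T_c → X^Σ(M)` (`X^Σ(𝓜) = XBig κ' (AnticyclotomicBigGaloisRep κ ρ) 𝔮 Σ` over
`Λ⟦T_c⟧`, the quotient a `Λ`-module through the constants `C`; `X^Σ(M) = XBig κ ρ 𝔮 Σ`) which is
SURJECTIVE, with KERNEL `⊥`, hence pseudo-null kernel.
[cite: JetchevSkinnerWan2017, Lemma 3.4.1 (arXiv:1512.06894 p. 14)] [cite: Castella2018Erratum, Lemma 2.1 (p. 2)] -/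
theorem exists_controlMap
    (hA : ∀ a : A, (∀ g : absoluteGaloisGroup K, ρ g a = a) → (∃ k : ℕ, p ^ k • a = 0) → a = 0)
    (hdec : ∀ a : A, (∀ σ : LocalGroup K (Sum.inl 𝔮), ρ (localMap K (Sum.inl 𝔮) σ) a = a) →
      (∃ k : ℕ, p ^ k • a = 0) → a = 0)
    (hunr : ∀ w : HeightOneSpectrum (𝓞 K), w ∉ S → ((p : ℕ) : 𝓞 K) ∉ w.asIdeal →
      ∀ (σ : LocalGroup K (Sum.inr w)) (a : A), ρ (localMap K (Sum.inr w) σ) a = a) :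
    ∃ f : (letI : _root_.Module (PowerSeries 𝒪)
              (QuotSMulTop (PowerSeries.X : PowerSeries (PowerSeries 𝒪))
                (XBig κ' (AnticyclotomicBigGaloisRep κ ρ) 𝔮 S)) :=
            Module.compHom _ (PowerSeries.C (R := PowerSeries 𝒪))
          QuotSMulTop (PowerSeries.X : PowerSeries (PowerSeries 𝒪))
              (XBig κ' (AnticyclotomicBigGaloisRep κ ρ) 𝔮 S) →ₗ[PowerSeries 𝒪] XBig κ ρ 𝔮 S),
      Function.Surjective f ∧
      (letI : _root_.Module (PowerSeries 𝒪)
            (QuotSMulTop (PowerSeries.X : PowerSeries (PowerSeries 𝒪))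
              (XBig κ' (AnticyclotomicBigGaloisRep κ ρ) 𝔮 S)) :=
          Module.compHom _ (PowerSeries.C (R := PowerSeries 𝒪))
       LinearMap.ker f = ⊥) ∧
      (letI : _root_.Module (PowerSeries 𝒪)
            (QuotSMulTop (PowerSeries.X : PowerSeries (PowerSeries 𝒪))
              (XBig κ' (AnticyclotomicBigGaloisRep κ ρ) 𝔮 S)) :=
          Module.compHom _ (PowerSeries.C (R := PowerSeries 𝒪))
       Literature.NumberTheory.EllipticCurves.Module.IsPseudoNull (PowerSeries 𝒪)
         (LinearMap.ker f)) := by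
  obtain ⟨θ, hinj, hC, hX, hsurj⟩ := exists_controlHom_selmerBig κ κ' ρ 𝔮 S hA hdec hunr
  obtain ⟨f, hfs, -, hker⟩ := ControlDual.exists_quotSMulTop_linearMap
    (PowerSeries.C (R := PowerSeries 𝒪)) (PowerSeries.X : PowerSeries (PowerSeries 𝒪)) θ hC hX
    hinj hsurj
  letI : _root_.Module (PowerSeries 𝒪)
      (QuotSMulTop (PowerSeries.X : PowerSeries (PowerSeries 𝒪))
        (XBig κ' (AnticyclotomicBigGaloisRep κ ρ) 𝔮 S)) :=
    Module.compHom _ (PowerSeries.C (R := PowerSeries 𝒪))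
  refine ⟨f, hfs, hker, ?_⟩
  haveI : Subsingleton (LinearMap.ker f) := by
    rw [hker]
    infer_instance
  exact Module.isPseudoNull_of_subsingleton _ _

/-- **`X^Σ(𝓜)` is a finitely generated `Λ⟦T_c⟧`-module** when `X^Σ(M)` is a finitely generated
`Λ`-module (under (glob), (dec), (unr)): `X^Σ(𝓜)` is `(T_c)`-separated (every class of
`H¹(Γ_K, 𝓜)` is killed by a power of `T_c`: `Γ_K` compact, `𝓜` discrete and `T_c`-primary),
`X^Σ(𝓜)/T_c ≅ X^Σ(M)`, and `Λ⟦T_c⟧` is `(T_c)`-adically complete (Mathlib) — complete Nakayama.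
"[`X^Σ_{Gr}(𝓜)`] is a finite `Λ_K`-module" ([JSW17, §3.4]).
[cite: JetchevSkinnerWan2017, §3.4 (arXiv:1512.06894 p. 14)] [cite: SkinnerUrban2014, Lemma 3.1.9 (p. 20)] -/
theorem module_finite_XBig_iterate
    (hA : ∀ a : A, (∀ g : absoluteGaloisGroup K, ρ g a = a) → (∃ k : ℕ, p ^ k • a = 0) → a = 0)
    (hdec : ∀ a : A, (∀ σ : LocalGroup K (Sum.inl 𝔮), ρ (localMap K (Sum.inl 𝔮) σ) a = a) →
      (∃ k : ℕ, p ^ k • a = 0) → a = 0)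
    (hunr : ∀ w : HeightOneSpectrum (𝓞 K), w ∉ S → ((p : ℕ) : 𝓞 K) ∉ w.asIdeal →
      ∀ (σ : LocalGroup K (Sum.inr w)) (a : A), ρ (localMap K (Sum.inr w) σ) a = a)
    [Module.Finite (PowerSeries 𝒪) (XBig κ ρ 𝔮 S)] :
    Module.Finite (PowerSeries (PowerSeries 𝒪)) (XBig κ' (AnticyclotomicBigGaloisRep κ ρ) 𝔮 S) := by
  obtain ⟨θ, hinj, hC, hX, hsurj⟩ := exists_controlHom_selmerBig κ κ' ρ 𝔮 S hA hdec hunr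
  refine ControlDual.module_finite_characterModule (PowerSeries.C (R := PowerSeries 𝒪))
    (PowerSeries.X : PowerSeries (PowerSeries 𝒪)) θ hC hX hinj hsurj fun y ↦ ?_
  -- every Selmer class of `𝓜` is `T_c`-power torsion
  obtain ⟨n, hn⟩ := BigGaloisRep.exists_pow_smul_eq_zero
    (AnticyclotomicBigGaloisRep κ' (AnticyclotomicBigGaloisRep κ ρ)).toTopRep
    (PowerSeries.X : PowerSeries (PowerSeries 𝒪)) BigRepModule.exists_X_pow_smul_eq_zero
    (y : continuousCohomology 1 (AnticyclotomicBigGaloisRep κ' (AnticyclotomicBigGaloisRep κ ρ)).toTopRep)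
  exact ⟨n, Subtype.ext (by rw [Submodule.coe_smul, hn, Submodule.coe_zero])⟩

end Control

/-! ## §3 The newform instance: `A_g = K²/𝒪²` of an ordinary newform datum -/

section Newform

open Literature.NumberTheory.EllipticCurves.GreenbergSelmer
  Literature.NumberTheory.EllipticCurves.ModularForms

set_option maxHeartbeats 800000 in
-- statement cost (the registered stub's conclusion shape over the iterated big representation), proof is glue
/-- **Two-variable control for `A_g`** — the conclusion of the stub `stub_control` of the line
`erratum_chain` of crux 25505 (v2, RULING 51), PROVED for an ordinary newform datum `Δ` of a NEWFORM
`g ∈ S_k(Γ₀(M))` (`𝒪 = padicCoeffIntegers ι_g`, `A_g = Cofree Δ.ρ`), any number field `K`, any two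
`ℤ_p`-extensions `κ` (the "anticyclotomic" inner variable `T_a`) and `κ'` (the "cyclotomic" outer
variable `T_c`), any strict prime `𝔭̄` and any finite `Σ ⊇ {w ∣ M}`, UNDER: (glob) `A_g` has no non-zero
`Γ_K`-fixed `p`-power-torsion element ((irr_K) in element form) and (dec) no non-zero
`Γ_{K_𝔭̄}`-fixed one (erratum Lemma 2.1: "`H⁰(K_𝔭̄, A_g[ϖ]) = 0`"). Conclusion: `X^Σ_K(A_g) =
XBig κ' (AnticyclotomicBigGaloisRep κ (A_g|_{Γ_K})) 𝔭̄ Σ` is a finitely generated `Λ_K`-module AND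
there is a surjective `Λ_𝒪`-linear `X^Σ_K(A_g)/T_c → X^Σ_ac(A_g)` with pseudo-null (indeed zero)
kernel. The (HT) hypothesis of [JSW17, §3.1] is NOT used (and is not consumable for the tree's
untwisted `A_g`); (dec) replaces it.
[cite: JetchevSkinnerWan2017, §3.4 ("a finite Λ_K-module") and Lemma 3.4.1 (arXiv:1512.06894 p. 14)]
[cite: Castella2018Erratum, Lemma 2.1 (p. 2)] [cite: SkinnerUrban2014, Lemma 3.1.9 (p. 20)] -/
theorem control_newform {p : ℕ} [Fact p.Prime] {M : ℕ} [NeZero M] {k : ℤ}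
    (g : CuspForm (CongruenceSubgroup.Gamma0 M) k) (ιg : coeffField g →+* PadicAlgCl p)
    (Δ : OrdinaryNewformDatum g p ιg)
    (K : Type) [Field K] [NumberField K] (𝔭bar : HeightOneSpectrum (𝓞 K))
    (κ κ' : ZpExtension K p) (S : Finset (HeightOneSpectrum (𝓞 K)))
    (hnf : IsNewform0 g)
    (hSM : ∀ w : HeightOneSpectrum (𝓞 K), ((M : ℕ) : 𝓞 K) ∈ w.asIdeal → w ∈ S)
    (hglob : ∀ a : Cofree Δ.ρ (padicCoeffField ιg),
      (∀ σ : absoluteGaloisGroup K, (Δ.cofreeRepOver K) σ a = a) → (∃ j : ℕ, p ^ j • a = 0) → a = 0)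
    (hdec : ∀ a : Cofree Δ.ρ (padicCoeffField ιg),
      (∀ σ : LocalGroup K (Sum.inl 𝔭bar), (Δ.cofreeRepOver K) (localMap K (Sum.inl 𝔭bar) σ) a = a) →
      (∃ j : ℕ, p ^ j • a = 0) → a = 0)
    [TopologicalSpace (PowerSeries (padicCoeffIntegers ιg))]
    [ContinuousSMul (PowerSeries (padicCoeffIntegers ιg))
      (BigRepModule (padicCoeffIntegers ιg) p (Cofree Δ.ρ (padicCoeffField ιg)))]
    [TopologicalSpace (PowerSeries (PowerSeries (padicCoeffIntegers ιg)))]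
    [ContinuousSMul (PowerSeries (PowerSeries (padicCoeffIntegers ιg)))
      (BigRepModule (PowerSeries (padicCoeffIntegers ιg)) p
        (BigRepModule (padicCoeffIntegers ιg) p (Cofree Δ.ρ (padicCoeffField ιg))))] :
    Module.Finite (PowerSeries (PowerSeries (padicCoeffIntegers ιg)))
        (XBig κ' (AnticyclotomicBigGaloisRep κ (Δ.cofreeRepOver K)) 𝔭bar (↑S)) ∧
    ∃ f : (letI : _root_.Module (PowerSeries (padicCoeffIntegers ιg))
              (QuotSMulTop (PowerSeries.X : PowerSeries (PowerSeries (padicCoeffIntegers ιg)))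
                (XBig κ' (AnticyclotomicBigGaloisRep κ (Δ.cofreeRepOver K)) 𝔭bar (↑S))) :=
            Module.compHom _ (PowerSeries.C (R := PowerSeries (padicCoeffIntegers ιg)))
      QuotSMulTop (PowerSeries.X : PowerSeries (PowerSeries (padicCoeffIntegers ιg)))
          (XBig κ' (AnticyclotomicBigGaloisRep κ (Δ.cofreeRepOver K)) 𝔭bar (↑S))
        →ₗ[PowerSeries (padicCoeffIntegers ιg)] XBig κ (Δ.cofreeRepOver K) 𝔭bar (↑S)),
      Function.Surjective f ∧
      (letI : _root_.Module (PowerSeries (padicCoeffIntegers ιg))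
              (QuotSMulTop (PowerSeries.X : PowerSeries (PowerSeries (padicCoeffIntegers ιg)))
                (XBig κ' (AnticyclotomicBigGaloisRep κ (Δ.cofreeRepOver K)) 𝔭bar (↑S))) :=
            Module.compHom _ (PowerSeries.C (R := PowerSeries (padicCoeffIntegers ιg)))
      Literature.NumberTheory.EllipticCurves.Module.IsPseudoNull (PowerSeries (padicCoeffIntegers ιg))
        (LinearMap.ker f)) := by
  have hSM' : ∀ w : HeightOneSpectrum (𝓞 K), w ∉ (↑S : Set (HeightOneSpectrum (𝓞 K))) →
      ((M : ℕ) : 𝓞 K) ∉ w.asIdeal := fun w hw hM ↦ hw (Finset.mem_coe.2 (hSM w hM))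
  have hunr := OrdinaryNewformDatum.cofreeRepOver_localMap_inr_apply_eq_self Δ (K := K) (↑S) hSM'
  haveI : Module.Finite (PowerSeries (padicCoeffIntegers ιg)) (XBig κ (Δ.cofreeRepOver K) 𝔭bar (↑S)) :=
    SkinnerUrban2014.moduleFinite_XBig_newform Δ (CoeffRing.finiteDimensional_padicCoeffField ιg hnf) K κ
      𝔭bar (↑S) S.finite_toSet hSM'
  refine ⟨module_finite_XBig_iterate κ κ' (Δ.cofreeRepOver K) 𝔭bar (↑S) hglob hdec hunr, ?_⟩
  -- the control map: `Exists.choose` keeps the binder types syntactically aligned (an `obtain`/re-pack of the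
  -- `letI`-typed package at the newform's data does not elaborate in reasonable time)
  have key := exists_controlMap κ κ' (Δ.cofreeRepOver K) 𝔭bar (↑S) hglob hdec hunr
  exact ⟨key.choose, key.choose_spec.1, key.choose_spec.2.2⟩

end Newform

end Summit.BirchSwinnertonDyer.BirchSwinnertonDyer.Theorems.ErratumThm23TwoVariable.ControlAt

end
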